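import Literature.MathematicalPhysics.QuantumFieldTheory.Balaban1983to89.B8Thm4InductionLocal
import Literature.MathematicalPhysics.QuantumFieldTheory.Balaban1983to89.B8Prop3KLevel

/-!
# `Balaban1983to89.B8Prop3GaugeFixedKLevel` — [Balaban1985RegularSpaces] PROPOSITION 3 (p. 87), FIRST MEMBER OF (1.36)/(1.62)
# «|A| < 5dLB₀(α₀ + α₁)(Lʲη)⁻¹ on Ω_j», FOR THE GAUGE-FIXED FIELDS `W = U′^{u⁻¹}` OF THEOREM 4's INDUCTION, AT `k` LEVELS ON THE
# CONCRETE `ℤᵈ` CARRIERS: the socket `hP3` of `B8Thm4InductionLocal.thm4_exists_all_levels` as a THEOREM modulo the in-edge b9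
# ((1.59) = Theorem 3.3 of [4]) and the (1.42) clause

statement-level skeleton of published theorems with citation tags; proofs where landed; nothing here is a claim about the
Yang–Mills mass gap

T. Bałaban, *Spaces of regular gauge field configurations on a lattice and gauge fixing conditions*, Commun. Math. Phys. **99**
(1985) 75–102 `[Balaban1985RegularSpaces]` ("B8"; printed page = PDF page + 74), Prop. 3 p. 87, (1.36)–(1.42) pp. 82–83, Theorem 4
p. 88 and its proof pp. 88–95 (p. 95: «Thus all the assumptions of Proposition 3 are satisfied and for α₀ + α₁ sufficiently small it
implies Theorem 4, except the uniqueness statement»); [3] = [Balaban1985Averaging], [4] = [Balaban1985BackgroundPropagators].  PDF held: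
`paper:balaban1985-cmp99-regular-spaces-gauge-fixing` (pp. 86–89, 91–95 read on the text layer, this unit 2026-08-26).  STATUS:
published, refereed.

CITATION HEADER (lean-in-tree rule).  Cell `pub-ymgap` (YM Track A, DAG node N05 = [B8], HUMAN RULING D-0062), seat
`pub-ymgap-dag-n04-b` (FIRST-MISSING-ESTIMATE hand of N04 = [3], re-pointed), gen 2; the OWNER'S CUT «hP3-discharge» named by the
N05 knit seat `pub-ymgap-dag-n05-a` g3 ([DAGN05A-G3-CUT-1], pub-ymgap INBOX 2026-08-26T01:47Z) and routed by dag-lead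
([REBALANCE-35]).  WHAT IS REPRODUCED = the USE of Proposition 3 inside Theorem 4's induction (the reset `B′₁ = C′₁B₁ ↦ B₁` between
two levels), i.e. the socket

  `hP3 : ∀ m, 1 ≤ m → m ≤ k → ∀ u W A, u unitary-valued → mgauge U₀ u W = U′ → Restr129 L m (Λs m) U₀ u → Lan m W →
     (∀ j ≤ m, ∀ b ∈ E j, W_b = cfgExp η A b ∧ ‖A_b‖ ≤ (2Lc⋆ + 8α₄)(Lʲη)⁻¹) → ∀ j ≤ m, ∀ b ∈ E j, ‖A_b‖ ≤ c⋆(Lʲη)⁻¹`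

of `B8Thm4InductionLocal.thm4_exists_all_levels` (p416373), at the pin's choices `E j := {b | SideTouches (Ω j) b}` (the sides of the
plaquettes touching `Ω_j` — the located reading G-B8-16 of (1.41), the currency of `B8Prop3KLevel`) and `c⋆ := 5dLB₀(α₀ + α₁)`.  Kind
«kernel-checked proof», theorems only: no `def`, no `… : Prop` fact, no existing module modified.  ENGINE BY NAME: n05-b's
`B8Prop3KLevel.prop3_norms_kLevel` (M3, p411479) — pp. 86–87 assembled at `k` levels.  REUSED BY NAME: `B8Thm4TruncationLocal.base_datum`
(the `(1/iη) log` of a unitary near `1` is self-adjoint and exponentiates back), `B7BlockAvgLog.mlog_exp`, `B8Ineq132.inAk_gaugeAct_iff`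
(gauge invariance of `𝔄_k`, p. 77), `B8Ineq132.norm_conjR`, `B7Eq106Concrete.mgauge_mgauge`, `B7Eq92Concrete.mgauge_mul`,
`B7Prop8PrintedConstants.Rc_mem_unitaryUnits`, `B8ScaledSupNorm.{bdd_of_forall, weight_mul_norm_le_msup, norm_le_of_msup_le,
weight_neg_natCast, msup_nonneg}`, `B8Eq140Level.{sideTouches_of_plaqTouches, sideTouches_of_bondNear, sideTouches_mono, plaqNear₁–₄,
isSide₁–₄, bondNear_of}`, `B7Prop1Local.hol_plaqWord_eq`, `B7Prop1Explicit.norm_exp_sub_one_le_of_norm_le`, Mathlib `Real.exp_bound'`,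
`Real.log_two_gt_d9`.

## THE PRINTED TEXT

p. 87 [PDF 13]: «Proposition 3. If U₀, U₁U₀ satisfy (1.40)–(1.42) with α₀, α₁, α₂ bounded by a constant depending on d and L only, and
α₂ satisfies the additional restriction (1.61), then U₁ satisfies (1.36)–(1.39) with B₁ = 5dLB₀, B₂(β₀) = 5dLB₀(β₀), where B₀, B₀(β₀)
are the corresponding norms of the operators G(U₀), H(U₀), and depend on d and L only, B₀(β₀) on β₀ also.»  p. 88 [PDF 14]: «Proposition
3 implies that it is enough to prove (1.37), (1.38) and U₁ = e^{iηA}, |A| < B′₁(α₀ + α₁)(Lʲη)⁻¹ on Ω_j, B′₁ = C′₁B₁ (1.67) with an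
absolute constant C′₁ (e.g., C′₁ = 2), instead of (1.36)–(1.39).»  p. 95 [PDF 21]: «(1.110) hence … (1.111) … Thus all the assumptions
of Proposition 3 are satisfied and for α₀ + α₁ sufficiently small it implies Theorem 4, except the uniqueness statement.»

## WHAT IS CERTIFIED HERE (kernel; axioms `propext` / `Classical.choice` / `Quot.sound`)

* §1 LOCALITY OF THE CLASS `𝔄_k({Ω_j}, α₀)` (p. 77): `plaqWord_congr_of_isSide`, `plaqF_congr_of_isSide` (a plaquette variable reads the
  four sides), `covDiv_congr_of_bondNear` ((1.2) at a bond reads the sides of the plaquettes through that bond, `B8Eq140Level.BondNear`),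
  **`condAt_congr_of_sideTouches`**, **`inAk_congr_of_sideTouches`** — (1.7)/(1.9) «on Ω_j» read the configuration ONLY on
  `SideTouches (Ω j)`; in particular the `covDiv` clause of `B8Ineq132.CondAt` reads NO bond beyond that layer (the check n05-a asked for:
  no boundary-layer item of the G-adv8-11 kind arises here).
* §2 GROUP ALGEBRA of `W = U′^{u⁻¹}`: `eq_mgauge_inv_of_mgauge_eq`, `mulCfg_eq_gaugeAct_of_mgauge_eq` (`WU₀ = (U′U₀)^{u⁻¹}`, [3] (55)/(8)).
* §3 THE DEVICE: `expCfg_iEta_eq_cfgExp` (the two exponent conventions agree), `log_cfgExp_eq` (`(1/iη) log e^{iηA_b} = A_b` for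
  `η‖A_b‖ ≤ 1/16`), `norm_cfgExp_sub_one_le` (`‖e^{iηA_b} − 1‖ ≤ 1/8`), **`logField_spec`** (for `W` unitary-valued and `W_b = e^{iηA_b}`
  with `η‖A_b‖ ≤ 1/16`: `A′_b := (1/iη) log W_b` equals `A_b`, is self-adjoint, and `W_b = e^{iηA′_b}`), `mem_unitaryUnits_of_mgauge_eq`
  (`W` is unitary-valued).
* §4 **`hP3_gaugeFixed_of_b9`** — THE SOCKET AS A THEOREM: for `1 ≤ m ≤ k`, `u` unitary-valued, `mgauge U₀ u W = U′`,
  `Restr129 L m (Λs m) U₀ u`, `Lan m W`, `W_b = e^{iηA_b}` and `‖A_b‖ ≤ (2Lc⋆ + 8α₄)(Lʲη)⁻¹` on `E j = SideTouches (Ω j)`, `j ≤ m`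
  ⇒ `‖A_b‖ ≤ c⋆(Lʲη)⁻¹` there, `c⋆ = 5dLB₀(α₀ + α₁)`.  PROOF = print's p. 87 for the exponent field `A′ := (1/iη) log W` MASKED to
  `⋃_{j ≤ m} E j` (self-adjoint everywhere, `= A` on the `E j`): (1.40) for `U₀` = (1.33) (`h33 : InAk L k η α₀ Ω U₀`); (1.40) for
  `e^{iηA′}U₀` = (1.34) `U′U₀ ∈ 𝔄_k({Ω_j}, α₀)` (`h34`) transported to `WU₀ = (U′U₀)^{u⁻¹}` by gauge invariance and to `e^{iηA′}U₀` by the §1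
  locality; (1.41) for `A′` = the hypothesis on `A`; then `B8Prop3KLevel.prop3_norms_kLevel` at `k := m`, `α₂ := 2Lc⋆ + 8α₄`, with
  `a := |A′|_(−1)`, `g := |∇^η_{U₀}A′|_(−2)` (weighted suprema over the `E j`, `B8ScaledSupNorm.msup`), and the pointwise reading.
* §5 **`thm4_exists_all_levels_of_b9`** — the COMPOSITION: `B8Thm4InductionLocal.thm4_exists_all_levels` with `hP3 :=` §4 (kernel check that
  the socket shape is met verbatim; `E` antitone from `Ω` antitone by `sideTouches_mono`): Theorem 4's existence clause at all levels on the
  concrete carriers now rests on Proposition 5 (sockets `hP5base`/`hP5`, in-edge-b9 letters), the (1.59) in-edge and the (1.42) clause only.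

## THE TWO REMAINING HYPOTHESES (per gauge-fixed `(u, W, A′)`; exactly what print takes from outside pp. 86–87)

* `H59` = THE IN-EDGE b9: the (1.59) bounds «Theorem 3.3 of [4] implies the bounds |A|_(−1), |∇^η_{U₀}A|_(−2), … ≦ B₀(|J|_(−3) + |B₁|)» for
  `A′`, first and gradient lines, in `prop3_norms_kLevel`'s currency (`h59a`/`h59g`: `bondNorm … (−3) Ω (Jcur η U₀ A′)` + the `wsup` of
  `LʲηQ_jA′` over the constraint bonds `Λb m j`).  This is where the Landau gauge `Lan m W` (1.38) and (1.29) are consumed in print (the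
  representation (1.57)–(1.58) `A = G(U₀)(…)`); a hypothesis of DAG node N05 (in-edge b9), NOT provable inside [B8].
* `H42` = the (1.42) clause «|Q_j(U₀, ηA′)| < 2dLα₁ on Λ_j» on the constraint bonds `Λb m j` (boxes inside `Ω_j`, `hbox`).  In print it
  follows from (1.29) + (1.35) through the construction (1.30)–(1.31) ((1.37) line); the tree has it in [3] Prop. 4's GLOBAL regime
  (`B8Eq137QjEqB` §8, `norm_Qj_lt_interior/crossing_of_inAx_restr129`: `pdev U₀` global, exponent field globally `O(L^{−k})`), whose
  TOWER-LOCAL k-level form (clamp to the block tower under the constraint bond, `B7Prop1Local.clampCfg` + `logCovIter_congr`) is the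
  companion item of this file — B8-internal, not yet typed.  Until then `H42` is an explicit hypothesis (honest partial delivery of the cut).

## HONEST SCOPE — what is NOT claimed

(i) Propositions 3 and 5 themselves are not re-proved (M3 by name; Prop. 5 = sockets `hP5base`/`hP5` of the driver, pin-bound letters
`G′, R, H′`).  (ii) `E j` = `SideTouches (Ω j)` (one layer wider than the p. 77 bond convention, G-B8-16) for BOTH the hypothesis (1.41) and
the conclusion (1.36) — the consistent located reading; `|A′|_(−1)` in `H59` is the weighted supremum over the same bonds.  (iii) The
constraint SITES `Λs m` (for (1.29)) and constraint BONDS `Λb m` (for (1.42)/(1.56)/(1.59)) are independent parameters here; their relation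
(«Λ_j bonds ⊂ Ω_j^{(j)}», interior/crossing geometry) is the business of the providers of `H42`/`H59` (`B8Eq131DomainSeq`).  (iv) Windows =
those of `prop3_norms_kLevel` verbatim at `α₂ = 2Lc⋆ + 8α₄` (explicit, merely sufficient; `16α₂ ≤ 1` also drives §3); `d ≥ 2`, `L ≥ 2`,
`𝔸` a C⋆-algebra, `U₀`, `U′` unitary-valued.  (v) `T_η ↦ ℤᵈ`; `≤` for print's `<`.  Nothing here discharges the node N05; count-neutral;
nothing continuum / mass-gap / Clay.
-/

noncomputable section

open NormedSpace

namespace Literature.MathematicalPhysics.QuantumFieldTheory.Balaban1983to89.B8Prop3GaugeFixedKLevel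

open Complex (I I_ne_zero)
open MatrixLog B7Prop1Explicit B7Prop2Explicit B7Prop1Local B7Eq92Concrete
open B8Lemma1NonAbelian (mulCfg)
open B8Ineq132 (covDerivFwd covDeriv covDiv plaqF InAk CondAt BondTouches PlaqTouches)
open B8Eq140Level (SideTouches IsSide PlaqNear BondNear sideTouches_of_plaqTouches sideTouches_of_bondNear
  plaqNear₁ plaqNear₂ plaqNear₃ plaqNear₄ isSide₁ isSide₂ isSide₃ isSide₄ bondNear_of)
open B8Eq119TwistedAxial (Restr129)
open B8Eq184Proof (gaugeExp cfgExp)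
open B8Eq146AExpansion (iEta expCfg)
open B7Prop4GeneralLevels (logCovIter linCovIter)
open B8Eq155JBound (Jcur wsup)
open B8ScaledSupNorm (bondNorm msup weight Bdd)
open B7Prop3Flat (c3)
open B7Eq78Linearization (conjR)

-- `Site` alone could resolve to the torus sites of `Setup.lean`; re-export the `ℤ^d` sites of `B7Prop1Explicit`.
export B7Prop1Explicit (Site)

variable {d : ℕ}

/-! ## §1 Locality of the class `𝔄_k({Ω_j}, α₀)`: (1.7)/(1.9) on `S` read the field on the sides of the plaquettes touching `S` only -/

section Locality

variable {G : Type*} [Group G]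

/-- A plaquette variable `V(∂p_{κν}(z))` ((9) of [3]) reads `V` on the four sides of `p_{κν}(z)` only. [cite: Balaban1985Averaging, (9) p.18] -/
theorem plaqWord_congr_of_isSide {V V' : Site d → Fin d → G} {z : Site d} {κ ν : Fin d}
    (h : ∀ y τ, IsSide z κ ν y τ → V y τ = V' y τ) :
    hol V z (plaqWord κ ν) = hol V' z (plaqWord κ ν) := by
  rw [hol_plaqWord_eq, hol_plaqWord_eq, h _ _ (isSide₁ z κ ν), h _ _ (isSide₂ z κ ν), h _ _ (isSide₃ z κ ν),
    h _ _ (isSide₄ z κ ν)]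

end Locality

section LocalityRing

variable {𝔸 : Type*} [NormedRing 𝔸] [NormedAlgebra ℂ 𝔸]

omit [NormedAlgebra ℂ 𝔸] in
/-- The plaquette field `F_{κν}(z)` (1.2) reads the configuration on the four sides of `p_{κν}(z)` only. [cite: Balaban1985RegularSpaces, (1.2) p.76] -/
theorem plaqF_congr_of_isSide {V V' : Site d → Fin d → 𝔸ˣ} {z : Site d} {κ ν : Fin d}
    (h : ∀ y τ, IsSide z κ ν y τ → V y τ = V' y τ) : plaqF V κ ν z = plaqF V' κ ν z := by
  unfold plaqF
  rw [plaqWord_congr_of_isSide h]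

/-- **LOCALITY OF (1.2)**: the covariant divergence `(D^{η*}_V ∂V)(⟨x, x + e_μ⟩)` reads `V` only on the sides of the plaquettes
through the bond `⟨x, x + e_μ⟩` (`B8Eq140Level.BondNear μ x`). [cite: Balaban1985RegularSpaces, (1.1)–(1.2) p.76] -/
theorem covDiv_congr_of_bondNear (η : ℝ) {V V' : Site d → Fin d → 𝔸ˣ} {μ : Fin d} {x : Site d}
    (h : ∀ y τ, BondNear μ x y τ → V y τ = V' y τ) : covDiv η V μ x = covDiv η V' μ x := by
  have key : ∀ ν, ν ≠ μ →
      V (x - e ν) ν = V' (x - e ν) ν ∧ plaqF V ν μ (x - e ν) = plaqF V' ν μ (x - e ν) ∧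
        plaqF V ν μ x = plaqF V' ν μ x ∧ plaqF V μ ν (x - e ν) = plaqF V' μ ν (x - e ν) ∧
        plaqF V μ ν x = plaqF V' μ ν x := by
    intro ν hνμ
    refine ⟨h _ _ (bondNear_of (plaqNear₃ hνμ) (isSide₁ _ ν μ)),
      plaqF_congr_of_isSide fun y τ hs => h y τ (bondNear_of (plaqNear₃ hνμ) hs),
      plaqF_congr_of_isSide fun y τ hs => h y τ (bondNear_of (plaqNear₁ hνμ) hs),
      plaqF_congr_of_isSide fun y τ hs => h y τ (bondNear_of (plaqNear₄ hνμ) hs),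
      plaqF_congr_of_isSide fun y τ hs => h y τ (bondNear_of (plaqNear₂ hνμ) hs)⟩
  unfold covDiv covDeriv
  congr 1
  · refine Finset.sum_congr rfl fun ν hν => ?_
    have hνμ : ν ≠ μ := (Finset.mem_Iio.mp hν).ne
    obtain ⟨h1, h2, h3, -, -⟩ := key ν hνμ
    rw [h1, h2, h3]
  · refine Finset.sum_congr rfl fun ν hν => ?_
    have hνμ : ν ≠ μ := (Finset.mem_Ioi.mp hν).ne'
    obtain ⟨h1, -, -, h4, h5⟩ := key ν hνμ
    rw [h1, h4, h5]

/-- **LOCALITY OF THE CLASS `𝔄_k`, ONE LEVEL**: the conditions (1.7) («`p ∈ Ω_j`») and (1.9) («`b ∈ Ω_j`») on a set `S` read the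
configuration ONLY on the sides of the plaquettes touching `S` (`B8Eq140Level.SideTouches S`): two configurations agreeing there satisfy
`CondAt … S` simultaneously. [cite: Balaban1985RegularSpaces, (1.7), (1.9) p.77] -/
theorem condAt_congr_of_sideTouches (L : ℕ) (η α : ℝ) (j : ℕ) {S : Set (Site d)} {V V' : Site d → Fin d → 𝔸ˣ}
    (h : ∀ y τ, SideTouches S y τ → V y τ = V' y τ) : CondAt L η α j S V ↔ CondAt L η α j S V' := by
  have hp : ∀ (x : Site d) (μ ν : Fin d), μ ≠ ν → PlaqTouches S x μ ν → plaqF V μ ν x = plaqF V' μ ν x :=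
    fun x μ ν hμν hpS => plaqF_congr_of_isSide fun y τ hs => h y τ (sideTouches_of_plaqTouches hμν hpS hs)
  have hc : ∀ (x : Site d) (μ : Fin d), BondTouches S x μ → covDiv η V μ x = covDiv η V' μ x :=
    fun x μ hb => covDiv_congr_of_bondNear η fun y τ hn => h y τ (sideTouches_of_bondNear hb hn)
  unfold CondAt
  constructor
  · rintro ⟨h7, h9⟩
    exact ⟨fun x μ ν hμν hpS => hp x μ ν hμν hpS ▸ h7 x μ ν hμν hpS, fun x μ hb => hc x μ hb ▸ h9 x μ hb⟩
  · rintro ⟨h7, h9⟩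
    exact ⟨fun x μ ν hμν hpS => (hp x μ ν hμν hpS).symm ▸ h7 x μ ν hμν hpS, fun x μ hb => (hc x μ hb).symm ▸ h9 x μ hb⟩

/-- **LOCALITY OF `𝔄_k({Ω_j}, α₀)`, ALL LEVELS**: two configurations agreeing, for every `j ≤ k`, on the sides of the plaquettes
touching `Ω_j` belong to `𝔄_k({Ω_j}, α₀)` simultaneously. [cite: Balaban1985RegularSpaces, (1.7), (1.9) p.77] -/
theorem inAk_congr_of_sideTouches (L k : ℕ) (η α : ℝ) {Ω : ℕ → Set (Site d)} {V V' : Site d → Fin d → 𝔸ˣ}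
    (h : ∀ j, j ≤ k → ∀ y τ, SideTouches (Ω j) y τ → V y τ = V' y τ) : InAk L k η α Ω V ↔ InAk L k η α Ω V' := by
  unfold InAk
  exact forall₂_congr fun j hj => condAt_congr_of_sideTouches L η α j (h j hj)

end LocalityRing

/-! ## §2 Group algebra of the gauge-fixed field `W = U′^{u⁻¹}` -/

section GroupAlgebra

variable {G : Type*} [Group G]

/-- `U′ = W^{u}` (moving frame (55)) iff `W = U′^{u⁻¹}`: the moving-frame action is a group action (`B7Eq106Concrete.mgauge_mgauge`).
[cite: Balaban1985Averaging, (55)–(57) p.27] -/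
theorem eq_mgauge_inv_of_mgauge_eq {V₀ : Site d → Fin d → G} {u : Site d → G} {W U' : Site d → Fin d → G}
    (hW : mgauge V₀ u W = U') : W = mgauge V₀ u⁻¹ U' := by
  rw [← hW, B7Eq106Concrete.mgauge_mgauge, inv_mul_cancel]
  funext x κ
  simp [mgauge_apply]

/-- `W·U₀ = (U′U₀)^{u⁻¹}` bondwise: the field `WU₀` is the ORDINARY gauge transform (8) of `U′U₀` by `u⁻¹` («if we write V = V′V₀,
then V^v = V′^vV₀», [3] p. 27; `B7Eq92Concrete.mgauge_mul`). [cite: Balaban1985Averaging, (55) p.27, (8) p.18] -/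
theorem mulCfg_eq_gaugeAct_of_mgauge_eq {V₀ : Site d → Fin d → G} {u : Site d → G} {W U' : Site d → Fin d → G}
    (hW : mgauge V₀ u W = U') : mulCfg W V₀ = gaugeAct u⁻¹ (mulCfg U' V₀) := by
  have h1 : mulCfg W V₀ = mgauge V₀ u⁻¹ U' * V₀ := by
    rw [← eq_mgauge_inv_of_mgauge_eq hW]; rfl
  rw [h1, mgauge_mul]
  rfl

end GroupAlgebra

/-! ## §3 The device: the exponent `A′ := (1/iη) log W` of a gauge-fixed field near `1`, masked to the relevant bonds -/

section Device

variable {𝔸 : Type*} [CStarAlgebra 𝔸] [Nontrivial 𝔸]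

omit [Nontrivial 𝔸] in
/-- `e^{iηA} = expCfg (iηA)`: the exponent conventions `cfgExp η A` (`B8Eq184Proof`) and `expCfg (iEta η A)` (`B8Eq146AExpansion`,
the currency of `B8Prop3KLevel`) name the same configuration. [cite: Balaban1985RegularSpaces, (1.36) p.82, (1.69) p.88] -/
theorem expCfg_iEta_eq_cfgExp (η : ℝ) (A : Site d → Fin d → 𝔸) : expCfg (iEta η A) = cfgExp η A := by
  funext x κ
  apply Units.ext
  show exp (((I : ℂ) * η) • A x κ) = exp ((I : ℂ) • (η • A x κ))
  rw [mul_smul, Complex.coe_smul]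

omit [Nontrivial 𝔸] in
/-- **THE LOGARITHM OF `W_b = e^{iηA_b}` IS `iηA_b`** for `η‖A_b‖ ≤ 1/16` (`log ∘ exp = id` on `‖·‖ < log 2`, `B7BlockAvgLog.mlog_exp`): the
exponent of a gauge field written as `e^{iηA}` with a small `A` is recovered from the field, `(1/iη) log W_b = A_b`.
[cite: Balaban1985RegularSpaces, (1.36) p.82 («U₁ = e^{iηA}»), (1.69) p.88; Balaban1985Averaging, (21)–(26) pp.21–22] -/
theorem log_cfgExp_eq {η : ℝ} (hη : 0 < η) {A : Site d → Fin d → 𝔸} {x : Site d} {κ : Fin d} {t : ℝ}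
    (hA : ‖A x κ‖ ≤ t * η⁻¹) (ht : t ≤ 1 / 16) :
    η⁻¹ • ((I⁻¹ : ℂ) • mlog ((cfgExp η A x κ : 𝔸ˣ) : 𝔸)) = A x κ := by
  have hC : ‖((I : ℂ) • (η • A x κ) : 𝔸)‖ < Real.log 2 := by
    rw [norm_smul, Complex.norm_I, one_mul, norm_smul, Real.norm_eq_abs, abs_of_pos hη]
    have h1 : η * ‖A x κ‖ ≤ t := by
      calc η * ‖A x κ‖ ≤ η * (t * η⁻¹) := mul_le_mul_of_nonneg_left hA hη.le
        _ = t := by field_simp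
    have := Real.log_two_gt_d9
    linarith
  show η⁻¹ • ((I⁻¹ : ℂ) • mlog (exp ((I : ℂ) • (η • A x κ)))) = A x κ
  rw [B7BlockAvgLog.mlog_exp hC, smul_smul (I⁻¹ : ℂ) I, inv_mul_cancel₀ I_ne_zero, one_smul, smul_smul, inv_mul_cancel₀ hη.ne',
    one_smul]

omit [Nontrivial 𝔸] in
/-- **`‖W_b − 1‖ ≤ 1/8`** for `W_b = e^{iηA_b}`, `η‖A_b‖ ≤ 1/16` (`‖e^{X} − 1‖ ≤ 2‖X‖` for `‖X‖ ≤ 1`).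
[cite: Balaban1985RegularSpaces, (1.69) p.88; Balaban1985Averaging, (26) p.22] -/
theorem norm_cfgExp_sub_one_le {η : ℝ} (hη : 0 < η) {A : Site d → Fin d → 𝔸} {x : Site d} {κ : Fin d} {t : ℝ}
    (hA : ‖A x κ‖ ≤ t * η⁻¹) (ht : t ≤ 1 / 16) : ‖((cfgExp η A x κ : 𝔸ˣ) : 𝔸) - 1‖ ≤ 1 / 8 := by
  have h1 : ‖((I : ℂ) • (η • A x κ) : 𝔸)‖ ≤ 1 / 16 := by
    rw [norm_smul, Complex.norm_I, one_mul, norm_smul, Real.norm_eq_abs, abs_of_pos hη]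
    calc η * ‖A x κ‖ ≤ η * (t * η⁻¹) := mul_le_mul_of_nonneg_left hA hη.le
      _ = t := by field_simp
      _ ≤ 1 / 16 := ht
  have h2 := (B7Prop1Explicit.norm_exp_sub_one_le_of_norm_le h1).1
  -- `e^{1/16} ≤ 1 + 2/16`
  have h3 : Real.exp (1 / 16 : ℝ) ≤ 1 + 1 / 8 := by
    have h := Real.exp_bound' (x := (1 / 16 : ℝ)) (by norm_num) (by norm_num) (n := 1) Nat.one_pos
    norm_num [Finset.sum_range_one] at h
    linarith
  show ‖exp ((I : ℂ) • (η • A x κ)) - (1 : 𝔸)‖ ≤ 1 / 8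
  linarith

omit [Nontrivial 𝔸] in
/-- **THE EXPONENT FIELD OF A UNITARY GAUGE-FIXED FIELD** (the device of this file): if `W_b` is unitary and `W_b = e^{iηA_b}` with
`η‖A_b‖ ≤ 1/16`, then `A′_b := (1/iη) log W_b` EQUALS `A_b`, is SELF-ADJOINT, and `W_b = e^{iηA′_b}` (`B8Thm4TruncationLocal.base_datum`:
`log` of a unitary within `1/4` of `1` is skew-adjoint, `B7Prop2Explicit.star_mlog_eq_neg`; `exp ∘ log = id`).  This is how a field
delivered on SOME bonds as `e^{iη·small}` (a gauge-fixed `W = U′^{u⁻¹}` of Theorem 4's induction) acquires a GLOBAL self-adjoint exponent.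
[cite: Balaban1985RegularSpaces, (1.36) p.82, (1.69) p.88, p.89 («A₀ = (1/iη) log U′»)] -/
theorem logField_spec {η : ℝ} (hη : 0 < η) (U₀ : Site d → Fin d → 𝔸ˣ) {W : Site d → Fin d → 𝔸ˣ}
    (hW : ∀ x κ, W x κ ∈ unitaryUnits 𝔸) {A : Site d → Fin d → 𝔸} {x : Site d} {κ : Fin d} {t : ℝ}
    (hWA : W x κ = cfgExp η A x κ) (hA : ‖A x κ‖ ≤ t * η⁻¹) (ht : t ≤ 1 / 16) :
    η⁻¹ • ((I⁻¹ : ℂ) • mlog ((W x κ : 𝔸ˣ) : 𝔸)) = A x κ ∧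
      IsSelfAdjoint (η⁻¹ • ((I⁻¹ : ℂ) • mlog ((W x κ : 𝔸ˣ) : 𝔸))) ∧
      W x κ = cfgExp η (fun y μ => η⁻¹ • ((I⁻¹ : ℂ) • mlog ((W y μ : 𝔸ˣ) : 𝔸))) x κ := by
  have hb : ‖((W x κ : 𝔸ˣ) : 𝔸) - 1‖ ≤ 1 / 8 := by rw [hWA]; exact norm_cfgExp_sub_one_le hη hA ht
  obtain ⟨-, hexp, hsa, -⟩ := B8Thm4TruncationLocal.base_datum hη U₀ W hW (by norm_num : (1 : ℝ) / 8 ≤ 1 / 4) x κ hb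
  refine ⟨?_, hsa, hexp⟩
  rw [hWA]
  exact log_cfgExp_eq hη hA ht

omit [Nontrivial 𝔸] in
/-- The gauge-fixed field `W = U′^{u⁻¹}` is unitary-valued when `U₀`, `U′`, `u` are. [cite: Balaban1985RegularSpaces, (1.17) p.78; Balaban1985Averaging, (55) p.27] -/
theorem mem_unitaryUnits_of_mgauge_eq {U₀ U' W : Site d → Fin d → 𝔸ˣ} {u : Site d → 𝔸ˣ}
    (hU₀ : ∀ x κ, U₀ x κ ∈ unitaryUnits 𝔸) (hU' : ∀ x κ, U' x κ ∈ unitaryUnits 𝔸) (hu : ∀ x, u x ∈ unitaryUnits 𝔸)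
    (hW : mgauge U₀ u W = U') (x : Site d) (κ : Fin d) : W x κ ∈ unitaryUnits 𝔸 := by
  rw [eq_mgauge_inv_of_mgauge_eq hW, mgauge_apply]
  have hui : ∀ y, u⁻¹ y ∈ unitaryUnits 𝔸 := fun y => (unitaryUnits 𝔸).inv_mem (hu y)
  refine (unitaryUnits 𝔸).mul_mem ((unitaryUnits 𝔸).mul_mem (hui x) (hU' x κ)) ((unitaryUnits 𝔸).inv_mem ?_)
  exact B7Prop8PrintedConstants.Rc_mem_unitaryUnits (hU₀ x κ) (hui _)

end Device

/-! ## §4 PROPOSITION 3 (first member of (1.36)) FOR GAUGE-FIXED FIELDS AT `k` LEVELS: the socket `hP3` of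
`B8Thm4InductionLocal.thm4_exists_all_levels` as a theorem modulo the in-edge b9 ((1.59)) and the (1.42) clause -/

section Main

variable {𝔸 : Type*} [CStarAlgebra 𝔸] [Nontrivial 𝔸]

omit [Nontrivial 𝔸] in
/-- `cfgExp η A` at a bond reads `A` at that bond only. [cite: Balaban1985RegularSpaces, (1.36) p.82] -/
theorem cfgExp_congr_at (η : ℝ) {A A' : Site d → Fin d → 𝔸} {x : Site d} {κ : Fin d} (h : A x κ = A' x κ) :
    cfgExp η A x κ = cfgExp η A' x κ := by
  apply Units.ext
  show exp ((I : ℂ) • (η • A x κ)) = exp ((I : ℂ) • (η • A' x κ))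
  rw [h]

/-- **THE SOCKET `hP3` OF `B8Thm4InductionLocal.thm4_exists_all_levels` AS A THEOREM, MODULO THE IN-EDGE b9 AND THE (1.42) CLAUSE.**
[Balaban1985RegularSpaces] Proposition 3 p. 87, first member of (1.36)/(1.62) «|A| < 5dLB₀(α₀ + α₁)(Lʲη)⁻¹ on Ω_j», for the GAUGE-FIXED
fields `W = U′^{u⁻¹}` that Theorem 4's induction produces (p. 95: «Thus all the assumptions of Proposition 3 are satisfied and for α₀ + α₁
sufficiently small it implies Theorem 4»), at `k` levels on the concrete `ℤᵈ` carriers, with the pin's choices `E j :=` the sides of the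
plaquettes touching `Ω_j` (`B8Eq140Level.SideTouches`, the located reading G-B8-16 of `B8Prop3KLevel`'s (1.41)) and `c⋆ := 5dLB₀(α₀ + α₁)`
(`hc`).  For `1 ≤ m ≤ k` and `(u, W, A)` with `u` unitary-valued, `W^{u} = U′` (moving frame (55) at `U₀`), (1.29) `Restr129 L m (Λs m) U₀ u`,
the Landau predicate `Lan m W`, and `W_b = e^{iηA_b}`, `‖A_b‖ ≤ (2Lc⋆ + 8α₄)(Lʲη)⁻¹` on `E j`, `j ≤ m`: **`‖A_b‖ ≤ c⋆(Lʲη)⁻¹` on `E j`, `j ≤ m`.**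

PROOF (print's one page pp. 86–87, assembled by `B8Prop3KLevel.prop3_norms_kLevel` at `k := m` levels, `α₂ := 2Lc⋆ + 8α₄`), for the
exponent field **`A′ := (1/iη) log W` masked to `⋃_{j ≤ m} E j`** (§3: self-adjoint EVERYWHERE, `= A` on the `E j`, `W = e^{iηA′}` there):
(1.40) for `U₀` is `h33`; (1.40) for `e^{iηA′}U₀` is (1.34) `U′U₀ ∈ 𝔄_k({Ω_j}, α₀)` (`h34`) moved to `WU₀ = (U′U₀)^{u⁻¹}` by the gauge
invariance of `𝔄_k` (`B8Ineq132.inAk_gaugeAct_iff`, p. 77) and then to `e^{iηA′}U₀` by the LOCALITY of `𝔄_k` (§1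
`inAk_congr_of_sideTouches`: (1.7)/(1.9) on `Ω_j` read the field on `E j` only, where `W = e^{iηA′}`); (1.41) for `A′` is the hypothesis
on `A`; the (1.59) bounds of Theorem 3.3 of [4] for `A′` (first and gradient lines, `h59a`/`h59g` of `prop3_norms_kLevel` with `a := |A′|_(−1)`,
`g := |∇^η_{U₀}A′|_(−2)` over the `E j`) are the hypothesis `H59` = THE IN-EDGE b9, stated per `(u, W, A′)` — that is where `Lan m W` and
(1.29) are consumed in print ((1.57)–(1.58)); the (1.42) clause «|Q_j(U₀, ηA′)| < 2dLα₁ on Λ_j» is the hypothesis `H42` per `(u, W, A′)` on the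
constraint bonds `Λb m j` (boxes in `Ω_j`, `hbox`) — in print it follows from (1.29) + (1.35) by the construction (1.30)–(1.31)
(`B8Eq137QjEqB` §8 gives it in [3] Prop. 4's GLOBAL regime; its tower-local k-level form is the companion item, not this file).
CONSTANTS: the windows of `prop3_norms_kLevel` verbatim at `α₂ = 2Lc⋆ + 8α₄` (explicit, merely sufficient; `16α₂ ≤ 1` also drives the
`log`/`exp` device of §3).  HONEST SCOPE: count-neutral; Propositions 3/5 themselves are not re-proved here (M3 by name); `d ≥ 2`.
[cite: Balaban1985RegularSpaces, Prop. 3 p.87, (1.62) p.87, (1.36) p.82, (1.40)–(1.42) p.83, Thm 4 p.88, p.95] -/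
theorem hP3_gaugeFixed_of_b9 (hd2 : 2 ≤ d) {η : ℝ} (hη : 0 < η) {L : ℕ} (hL : 2 ≤ L) (k : ℕ)
    {U₀ U' : Site d → Fin d → 𝔸ˣ} (hU₀ : ∀ x κ, U₀ x κ ∈ unitaryUnits 𝔸) (hU' : ∀ x κ, U' x κ ∈ unitaryUnits 𝔸)
    {α₀ α₁ α₄ B₀ cstar : ℝ} (hα₀ : 0 < α₀) (hα₁ : 0 ≤ α₁) (hα₄ : 0 ≤ α₄) (hB₀ : 0 ≤ B₀)
    (hc : cstar = 5 * d * L * B₀ * (α₀ + α₁))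
    (hα3 : C0 d * α₀ ≤ 1 / 3) (hα4 : 4 * α₀ ≤ c2' d L)
    (h16 : 16 * (2 * (L * cstar) + 8 * α₄) ≤ 1) (hd5 : 5 * (2 * (L * cstar) + 8 * α₄) * ((d : ℝ) - 1) ≤ 4)
    (hsmall : Real.exp (4 * (800 * ((d : ℝ) + 1) ^ 2 * ((d : ℝ) + 4)) * α₀)
      * (1 + 8 * (131072 * ((d : ℝ) + 1) ^ 2) * (2 * (L * cstar) + 8 * α₄)) ≤ 2)
    (hc₃ : 2 * (2 * (L * cstar) + 8 * α₄) ≤ c3 d L) (hside : 36 * d * B₀ * (2 * (L * cstar) + 8 * α₄) ≤ 1 / 2)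
    (h50 : 50 * d * (2 * (L * cstar) + 8 * α₄) ≤ 1)
    {C₂ : ℝ} (hC₂ : 8 * (131072 * ((d : ℝ) + 1) ^ 2) * Real.exp (4 * (800 * ((d : ℝ) + 1) ^ 2 * ((d : ℝ) + 4)) * α₀) ≤ C₂)
    (h61 : 2 * (2 * (L * cstar) + 8 * α₄) ^ 2 + 20 * d * α₀ * (2 * (L * cstar) + 8 * α₄)
      + 2 * C₂ * (2 * (L * cstar) + 8 * α₄) ^ 2 ≤ α₀ + α₁)
    (Ω : ℕ → Set (Site d)) (Λs : ℕ → ℕ → Set (Site d)) (Λb : ℕ → ℕ → Set (Site d × Fin d))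
    (hbox : ∀ m, m ≤ k → ∀ j, j ≤ m → ∀ c ∈ Λb m j, ∀ x, InBox (loK L j c.1) (bondHiK L j c.1 c.2) x → x ∈ Ω j)
    (h33 : InAk L k η α₀ Ω U₀) (h34 : InAk L k η α₀ Ω (mulCfg U' U₀))
    (Lan : ℕ → (Site d → Fin d → 𝔸ˣ) → Prop)
    (H42 : ∀ m, 1 ≤ m → m ≤ k → ∀ (u : Site d → 𝔸ˣ) (W : Site d → Fin d → 𝔸ˣ) (A' : Site d → Fin d → 𝔸),
      (∀ x, u x ∈ unitaryUnits 𝔸) → mgauge U₀ u W = U' → Restr129 L m (Λs m) U₀ u → Lan m W →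
      (∀ y τ, IsSelfAdjoint (A' y τ)) →
      (∀ j, j ≤ m → ∀ y τ, SideTouches (Ω j) y τ →
        W y τ = cfgExp η A' y τ ∧ ‖A' y τ‖ ≤ (2 * (L * cstar) + 8 * α₄) * ((L : ℝ) ^ j * η)⁻¹) →
      (∀ y τ, (∀ j, j ≤ m → ¬ SideTouches (Ω j) y τ) → A' y τ = 0) →
      ∀ j, j ≤ m → ∀ c ∈ Λb m j, ‖logCovIter L U₀ (iEta η A') j c.1 c.2‖ < 2 * d * L * α₁)
    (H59 : ∀ m, 1 ≤ m → m ≤ k → ∀ (u : Site d → 𝔸ˣ) (W : Site d → Fin d → 𝔸ˣ) (A' : Site d → Fin d → 𝔸),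
      (∀ x, u x ∈ unitaryUnits 𝔸) → mgauge U₀ u W = U' → Restr129 L m (Λs m) U₀ u → Lan m W →
      (∀ y τ, IsSelfAdjoint (A' y τ)) →
      (∀ j, j ≤ m → ∀ y τ, SideTouches (Ω j) y τ →
        W y τ = cfgExp η A' y τ ∧ ‖A' y τ‖ ≤ (2 * (L * cstar) + 8 * α₄) * ((L : ℝ) ^ j * η)⁻¹) →
      (∀ y τ, (∀ j, j ≤ m → ¬ SideTouches (Ω j) y τ) → A' y τ = 0) →
      msup L m η (-(1 : ℝ)) (fun j (b : Site d × Fin d) => SideTouches (Ω j) b.1 b.2) (fun b => A' b.1 b.2)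
          ≤ B₀ * (bondNorm L m η (-(3 : ℝ)) Ω (fun x μ => Jcur η U₀ A' μ x)
            + wsup 1 (fun p : {p : ℕ × (Site d × Fin d) // p.1 ≤ m ∧ p.2 ∈ Λb m p.1} =>
                linCovIter L U₀ (iEta η A') p.1.1 p.1.2.1 p.1.2.2)) ∧
        msup L m η (-(2 : ℝ)) (fun j (t : Fin d × Fin d × Site d) => SideTouches (Ω j) t.2.2 t.2.1)
            (fun t => covDerivFwd η U₀ t.1 (fun z => A' z t.2.1) t.2.2)
          ≤ B₀ * (bondNorm L m η (-(3 : ℝ)) Ω (fun x μ => Jcur η U₀ A' μ x)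
            + wsup 1 (fun p : {p : ℕ × (Site d × Fin d) // p.1 ≤ m ∧ p.2 ∈ Λb m p.1} =>
                linCovIter L U₀ (iEta η A') p.1.1 p.1.2.1 p.1.2.2))) :
    ∀ m, 1 ≤ m → m ≤ k → ∀ (u : Site d → 𝔸ˣ) (W : Site d → Fin d → 𝔸ˣ) (A : Site d → Fin d → 𝔸),
      (∀ x, u x ∈ unitaryUnits 𝔸) → mgauge U₀ u W = U' → Restr129 L m (Λs m) U₀ u → Lan m W →
      (∀ j, j ≤ m → ∀ b ∈ {b : Site d × Fin d | SideTouches (Ω j) b.1 b.2},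
        W b.1 b.2 = cfgExp η A b.1 b.2 ∧ ‖A b.1 b.2‖ ≤ (2 * (L * cstar) + 8 * α₄) * ((L : ℝ) ^ j * η)⁻¹) →
      ∀ j, j ≤ m → ∀ b ∈ {b : Site d × Fin d | SideTouches (Ω j) b.1 b.2},
        ‖A b.1 b.2‖ ≤ cstar * ((L : ℝ) ^ j * η)⁻¹ := by
  intro m hm1 hmk u W A hu hW h129 hLan hWA j₀ hj₀ b₀ hb₀
  have hL1 : 1 ≤ L := le_trans (by norm_num) hL
  have hLr : (1 : ℝ) ≤ L := by exact_mod_cast hL1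
  set α₂ : ℝ := 2 * (L * cstar) + 8 * α₄ with hα₂_def
  have hcstar : 0 ≤ cstar := by rw [hc]; positivity
  have hα₂ : 0 ≤ α₂ := by positivity
  have hα₂16 : α₂ ≤ 1 / 16 := by linarith
  -- `W` is unitary-valued
  have hWu : ∀ x κ, W x κ ∈ unitaryUnits 𝔸 := mem_unitaryUnits_of_mgauge_eq hU₀ hU' hu hW
  -- the bonds where the socket delivers `W = e^{iηA}`
  set M : Set (Site d × Fin d) := {b | ∃ j, j ≤ m ∧ SideTouches (Ω j) b.1 b.2} with hM_def
  -- the masked exponent field `A′ := (1/iη) log W` on `M`, `0` elsewhere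
  set A' : Site d → Fin d → 𝔸 :=
    fun y τ => M.indicator (fun b : Site d × Fin d => η⁻¹ • ((I⁻¹ : ℂ) • mlog ((W b.1 b.2 : 𝔸ˣ) : 𝔸))) (y, τ) with hA'_def
  -- on a socket bond: `A′ = A`, self-adjoint, `W = e^{iηA′}`
  have hsock : ∀ j, j ≤ m → ∀ y τ, SideTouches (Ω j) y τ →
      A' y τ = A y τ ∧ IsSelfAdjoint (A' y τ) ∧ W y τ = cfgExp η A' y τ := by
    intro j hj y τ hs
    have hmem : (y, τ) ∈ M := ⟨j, hj, hs⟩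
    obtain ⟨hWA₁, hA₁⟩ := hWA j hj (y, τ) hs
    have hLj : (1 : ℝ) ≤ (L : ℝ) ^ j := one_le_pow₀ hLr
    have hA₂ : ‖A y τ‖ ≤ α₂ * η⁻¹ := by
      calc ‖A y τ‖ ≤ α₂ * ((L : ℝ) ^ j * η)⁻¹ := hA₁
        _ = α₂ * η⁻¹ * ((L : ℝ) ^ j)⁻¹ := by rw [mul_inv]; ring
        _ ≤ α₂ * η⁻¹ * 1 := by
            apply mul_le_mul_of_nonneg_left (inv_le_one_of_one_le₀ hLj) (by positivity)
        _ = α₂ * η⁻¹ := mul_one _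
    obtain ⟨hlog, hsa, hexp⟩ := logField_spec hη U₀ hWu hWA₁ hA₂ hα₂16
    have hA'y : A' y τ = η⁻¹ • ((I⁻¹ : ℂ) • mlog ((W y τ : 𝔸ˣ) : 𝔸)) := by
      simp only [hA'_def, Set.indicator_of_mem hmem]
    refine ⟨by rw [hA'y, hlog], by rw [hA'y]; exact hsa, ?_⟩
    rw [hexp]
    exact cfgExp_congr_at η hA'y.symm
  have hA'0 : ∀ y τ, (∀ j, j ≤ m → ¬ SideTouches (Ω j) y τ) → A' y τ = 0 := by
    intro y τ h
    have hnot : (y, τ) ∉ M := fun ⟨j, hj, hs⟩ => h j hj hs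
    simp only [hA'_def, Set.indicator_of_notMem hnot]
  have hA'sa : ∀ y τ, IsSelfAdjoint (A' y τ) := by
    intro y τ
    by_cases hmem : (y, τ) ∈ M
    · obtain ⟨j, hj, hs⟩ := hmem
      exact (hsock j hj y τ hs).2.1
    · have : A' y τ = 0 := by simp only [hA'_def, Set.indicator_of_notMem hmem]
      rw [this]; exact IsSelfAdjoint.zero 𝔸
  have hA'41 : ∀ j, j ≤ m → ∀ y τ, SideTouches (Ω j) y τ →
      W y τ = cfgExp η A' y τ ∧ ‖A' y τ‖ ≤ α₂ * ((L : ℝ) ^ j * η)⁻¹ := by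
    intro j hj y τ hs
    obtain ⟨hAA, -, hWe⟩ := hsock j hj y τ hs
    exact ⟨hWe, by rw [hAA]; exact (hWA j hj (y, τ) hs).2⟩
  -- global bound `‖A′‖ ≤ α₂η⁻¹`
  have hA'glob : ∀ y τ, ‖A' y τ‖ ≤ α₂ * η⁻¹ := by
    intro y τ
    by_cases hmem : (y, τ) ∈ M
    · obtain ⟨j, hj, hs⟩ := hmem
      have hLj : (1 : ℝ) ≤ (L : ℝ) ^ j := one_le_pow₀ hLr
      calc ‖A' y τ‖ ≤ α₂ * ((L : ℝ) ^ j * η)⁻¹ := (hA'41 j hj y τ hs).2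
        _ = α₂ * η⁻¹ * ((L : ℝ) ^ j)⁻¹ := by rw [mul_inv]; ring
        _ ≤ α₂ * η⁻¹ * 1 := by
            apply mul_le_mul_of_nonneg_left (inv_le_one_of_one_le₀ hLj) (by positivity)
        _ = α₂ * η⁻¹ := mul_one _
    · have : A' y τ = 0 := by simp only [hA'_def, Set.indicator_of_notMem hmem]
      rw [this, norm_zero]; positivity
  -- the in-edge (1.59) and the (1.42) clause for `A′`
  obtain ⟨h59a, h59g⟩ := H59 m hm1 hmk u W A' hu hW h129 hLan hA'sa hA'41 hA'0
  have h42 := H42 m hm1 hmk u W A' hu hW h129 hLan hA'sa hA'41 hA'0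
  -- (1.40) for `U₀` and for `e^{iηA′}U₀` at the `m` levels
  have h40₀ : InAk L m η α₀ Ω U₀ := fun j hj => h33 j (hj.trans hmk)
  have h40W : InAk L m η α₀ Ω (mulCfg W U₀) := by
    have h1 : InAk L m η α₀ Ω (mulCfg U' U₀) := fun j hj => h34 j (hj.trans hmk)
    have hui : ∀ x, u⁻¹ x ∈ U1 𝔸 := fun x => unitaryUnits_le_U1 ((unitaryUnits 𝔸).inv_mem (hu x))
    rw [mulCfg_eq_gaugeAct_of_mgauge_eq hW]
    exact (B8Ineq132.inAk_gaugeAct_iff L m η α₀ Ω hui _).2 h1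
  have h40₁ : InAk L m η α₀ Ω (mulCfg (expCfg (iEta η A')) U₀) := by
    refine (inAk_congr_of_sideTouches L m η α₀ (V := mulCfg W U₀) fun j hj y τ hs => ?_).1 h40W
    show W y τ * U₀ y τ = expCfg (iEta η A') y τ * U₀ y τ
    rw [(hA'41 j hj y τ hs).1, expCfg_iEta_eq_cfgExp]
  -- boundedness of the two weighted families and the gradient datum
  have hBa : Bdd L m η (-(1 : ℝ)) (fun j (b : Site d × Fin d) => SideTouches (Ω j) b.1 b.2) fun b => A' b.1 b.2 := by
    have e1 : (-(1 : ℝ)) = -((1 : ℕ) : ℝ) := by norm_num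
    rw [e1]
    refine B8ScaledSupNorm.bdd_of_forall (c := α₂) fun j hj b hb => ?_
    have hs : 0 < (L : ℝ) ^ j * η := B8ScaledSupNorm.scale_pos hL1 hη j
    rw [B8ScaledSupNorm.weight_neg_natCast L η 1 j, pow_one]
    calc (L : ℝ) ^ j * η * ‖A' b.1 b.2‖ ≤ (L : ℝ) ^ j * η * (α₂ * ((L : ℝ) ^ j * η)⁻¹) :=
        mul_le_mul_of_nonneg_left (hA'41 j hj b.1 b.2 hb).2 hs.le
      _ = α₂ := by field_simp
  have hU₀1 : ∀ x κ, U₀ x κ ∈ U1 𝔸 := fun x κ => unitaryUnits_le_U1 (hU₀ x κ)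
  have hgrad : ∀ (y : Site d) (κ τ : Fin d), ‖covDerivFwd η U₀ κ (fun z => A' z τ) y‖ ≤ 2 * α₂ * η⁻¹ * η⁻¹ := by
    intro y κ τ
    unfold covDerivFwd
    rw [norm_smul, norm_inv, Real.norm_eq_abs, abs_of_pos hη]
    have h1 : ‖conjR (U₀ y κ) (A' (y + e κ) τ) - A' y τ‖ ≤ α₂ * η⁻¹ + α₂ * η⁻¹ := by
      calc ‖conjR (U₀ y κ) (A' (y + e κ) τ) - A' y τ‖
          ≤ ‖conjR (U₀ y κ) (A' (y + e κ) τ)‖ + ‖A' y τ‖ := norm_sub_le _ _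
        _ ≤ α₂ * η⁻¹ + α₂ * η⁻¹ := by
            rw [B8Ineq132.norm_conjR (hU₀1 y κ)]
            exact add_le_add (hA'glob _ _) (hA'glob _ _)
    calc η⁻¹ * ‖conjR (U₀ y κ) (A' (y + e κ) τ) - A' y τ‖ ≤ η⁻¹ * (α₂ * η⁻¹ + α₂ * η⁻¹) :=
        mul_le_mul_of_nonneg_left h1 (by positivity)
      _ = 2 * α₂ * η⁻¹ * η⁻¹ := by ring
  have hBg : Bdd L m η (-(2 : ℝ)) (fun j (t : Fin d × Fin d × Site d) => SideTouches (Ω j) t.2.2 t.2.1)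
      (fun t => covDerivFwd η U₀ t.1 (fun z => A' z t.2.1) t.2.2) := by
    have e2 : (-(2 : ℝ)) = -((2 : ℕ) : ℝ) := by norm_num
    rw [e2]
    refine B8ScaledSupNorm.bdd_of_forall (c := 2 * α₂ * ((L : ℝ) ^ m) ^ 2) fun j hj t _ => ?_
    rw [B8ScaledSupNorm.weight_neg_natCast L η 2 j]
    have hLjm : (L : ℝ) ^ j ≤ (L : ℝ) ^ m := pow_le_pow_right₀ hLr hj
    have hLj0 : (0 : ℝ) ≤ (L : ℝ) ^ j := by positivity
    calc ((L : ℝ) ^ j * η) ^ 2 * ‖covDerivFwd η U₀ t.1 (fun z => A' z t.2.1) t.2.2‖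
        ≤ ((L : ℝ) ^ j * η) ^ 2 * (2 * α₂ * η⁻¹ * η⁻¹) := mul_le_mul_of_nonneg_left (hgrad _ _ _) (by positivity)
      _ = 2 * α₂ * ((L : ℝ) ^ j) ^ 2 := by field_simp
      _ ≤ 2 * α₂ * ((L : ℝ) ^ m) ^ 2 := by gcongr
  set g : ℝ := msup L m η (-(2 : ℝ)) (fun j (t : Fin d × Fin d × Site d) => SideTouches (Ω j) t.2.2 t.2.1)
      (fun t => covDerivFwd η U₀ t.1 (fun z => A' z t.2.1) t.2.2) with hg_def
  have hg0 : 0 ≤ g := B8ScaledSupNorm.msup_nonneg L m hη.le _ _ _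
  have hg : ∀ j, j ≤ m → ∀ (y : Site d) (κ τ : Fin d), SideTouches (Ω j) y τ →
      ((L : ℝ) ^ j * η) ^ 2 * ‖covDerivFwd η U₀ κ (fun z => A' z τ) y‖ ≤ g := by
    intro j hj y κ τ hs
    have h := B8ScaledSupNorm.weight_mul_norm_le_msup hBg hj (i := (κ, τ, y)) hs
    have hw : weight L η (-(2 : ℝ)) j = ((L : ℝ) ^ j * η) ^ 2 := by
      have e2 : (-(2 : ℝ)) = -((2 : ℕ) : ℝ) := by norm_num
      rw [e2, B8ScaledSupNorm.weight_neg_natCast L η 2 j]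
    rw [hw] at h
    exact h
  -- PROPOSITION 3 at `m` levels for `A′` (n05-b's `prop3_norms_kLevel`)
  obtain ⟨ha, -, -, -⟩ := B8Prop3KLevel.prop3_norms_kLevel hd2 hη hL hU₀ hA'sa hα₀ hα₁ hα₂ hg0 hα3 hα4 h16 hd5 hsmall hc₃
    hB₀ hside h50 hC₂ h61 (hbox m hmk) h40₀ h40₁ (fun j hj y τ hs => (hA'41 j hj y τ hs).2) hg h42 h59a h59g h59a h59a
  -- pointwise on the socket bond, and back to `A`
  have hpt := B8ScaledSupNorm.norm_le_of_msup_le hL1 hη hBa ha hj₀ (i := b₀) hb₀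
  rw [Real.rpow_neg_one] at hpt
  obtain ⟨hAA, -, -⟩ := hsock j₀ hj₀ b₀.1 b₀.2 hb₀
  rw [← hAA, hc]
  exact hpt

/-! ## §5 The composition: Theorem 4's existence clause at all levels with the socket `hP3` DISCHARGED (modulo Prop. 5, b9, (1.42)) -/

/-- **THEOREM 4, EXISTENCE CLAUSE AT ALL LEVELS, ON THE CONCRETE `ℤᵈ` CARRIERS — `B8Thm4InductionLocal.thm4_exists_all_levels` WITH ITS
SOCKET `hP3` SERVED BY `hP3_gaugeFixed_of_b9`** at the pin's choices `E j :=` the sides of the plaquettes touching `Ω_j` (antitone because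
`Ω` is, (1.3)) and `c⋆ = 5dLB₀(α₀ + α₁)`: for every `m ≤ k` a unitary-valued `u` with (1.29) at `m` levels whose `W = U′^{u⁻¹}` satisfies
`Lan m W` (`m ≥ 1`) and `W_b = e^{iηA_b}`, `A_b` self-adjoint, `‖A_b‖ ≤ c⋆(Lʲη)⁻¹` on `E j`, `j ≤ m` — MODULO Proposition 5 (the sockets
`hP5base`/`hP5`, in-edge-b9 letters), the (1.59) in-edge `H59` and the (1.42) clause `H42` (both per gauge-fixed `(u, W, A′)`), and
(1.33)/(1.34) `U₀, U′U₀ ∈ 𝔄_k({Ω_j}, α₀)`, (1.66)₀ `‖U′_b − 1‖ ≤ a` on `E 0`.  Kernel check that the socket shape is met verbatim.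
[cite: Balaban1985RegularSpaces, Thm 4 p.88, Prop. 3 p.87, Prop. 5 p.94, pp.94–95] -/
theorem thm4_exists_all_levels_of_b9 (hd2 : 2 ≤ d) {η : ℝ} (hη : 0 < η) {L : ℕ} (hL : 2 ≤ L) (k : ℕ)
    {U₀ U' : Site d → Fin d → 𝔸ˣ} (hU₀ : ∀ x κ, U₀ x κ ∈ unitaryUnits 𝔸) (hU' : ∀ x κ, U' x κ ∈ unitaryUnits 𝔸)
    {α₀ α₁ α₄ B₀ cstar a : ℝ} (hα₀ : 0 < α₀) (hα₁ : 0 ≤ α₁) (hα₄ : 0 ≤ α₄) (hB₀ : 0 ≤ B₀)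
    (hc : cstar = 5 * d * L * B₀ * (α₀ + α₁))
    (hs₁ : α₄ ≤ 1 / 84) (hs₂ : L * cstar ≤ 1 / 12) (ha : a ≤ 1 / 4) (ha2 : 2 * a ≤ cstar)
    (hα3 : C0 d * α₀ ≤ 1 / 3) (hα4 : 4 * α₀ ≤ c2' d L)
    (h16 : 16 * (2 * (L * cstar) + 8 * α₄) ≤ 1) (hd5 : 5 * (2 * (L * cstar) + 8 * α₄) * ((d : ℝ) - 1) ≤ 4)
    (hsmall : Real.exp (4 * (800 * ((d : ℝ) + 1) ^ 2 * ((d : ℝ) + 4)) * α₀)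
      * (1 + 8 * (131072 * ((d : ℝ) + 1) ^ 2) * (2 * (L * cstar) + 8 * α₄)) ≤ 2)
    (hc₃ : 2 * (2 * (L * cstar) + 8 * α₄) ≤ c3 d L) (hside : 36 * d * B₀ * (2 * (L * cstar) + 8 * α₄) ≤ 1 / 2)
    (h50 : 50 * d * (2 * (L * cstar) + 8 * α₄) ≤ 1)
    {C₂ : ℝ} (hC₂ : 8 * (131072 * ((d : ℝ) + 1) ^ 2) * Real.exp (4 * (800 * ((d : ℝ) + 1) ^ 2 * ((d : ℝ) + 4)) * α₀) ≤ C₂)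
    (h61 : 2 * (2 * (L * cstar) + 8 * α₄) ^ 2 + 20 * d * α₀ * (2 * (L * cstar) + 8 * α₄)
      + 2 * C₂ * (2 * (L * cstar) + 8 * α₄) ^ 2 ≤ α₀ + α₁)
    (Ω : ℕ → Set (Site d)) (hΩ : ∀ j, Ω (j + 1) ⊆ Ω j) (Λs : ℕ → ℕ → Set (Site d)) (Λb : ℕ → ℕ → Set (Site d × Fin d))
    (hbox : ∀ m, m ≤ k → ∀ j, j ≤ m → ∀ c ∈ Λb m j, ∀ x, InBox (loK L j c.1) (bondHiK L j c.1 c.2) x → x ∈ Ω j)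
    (h33 : InAk L k η α₀ Ω U₀) (h34 : InAk L k η α₀ Ω (mulCfg U' U₀))
    (h66 : ∀ b ∈ {b : Site d × Fin d | SideTouches (Ω 0) b.1 b.2}, ‖((U' b.1 b.2 : 𝔸ˣ) : 𝔸) - 1‖ ≤ a)
    (Lan : ℕ → (Site d → Fin d → 𝔸ˣ) → Prop)
    (hP5base : ∃ (v : Site d → 𝔸ˣ) (lam : Site d → 𝔸), (∀ x, v x ∈ unitaryUnits 𝔸) ∧
        (∀ j, j ≤ 1 → ∀ b ∈ {b : Site d × Fin d | SideTouches (Ω j) b.1 b.2}, (v b.1 : 𝔸) = ((gaugeExp lam b.1 : 𝔸ˣ) : 𝔸) ∧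
          (v (b.1 + e b.2) : 𝔸) = ((gaugeExp lam (b.1 + e b.2) : 𝔸ˣ) : 𝔸)) ∧
        (∀ j, j ≤ 1 → ∀ b ∈ {b : Site d × Fin d | SideTouches (Ω j) b.1 b.2},
          ‖lam b.1‖ ≤ α₄ ∧ ((L : ℝ) ^ j * η) * ‖covDerivFwd η U₀ b.2 lam b.1‖ ≤ α₄) ∧
        Lan 1 (mgauge U₀ v⁻¹ U') ∧ Restr129 L 1 (Λs 1) U₀ ((1 : Site d → 𝔸ˣ) * v))
    (hP5 : ∀ m, 1 ≤ m → m < k → ∀ (u₁ : Site d → 𝔸ˣ) (U₁ : Site d → Fin d → 𝔸ˣ) (A : Site d → Fin d → 𝔸),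
      (∀ x, u₁ x ∈ unitaryUnits 𝔸) → mgauge U₀ u₁ U₁ = U' → Restr129 L m (Λs m) U₀ u₁ → Lan m U₁ →
      (∀ j, j ≤ m → ∀ b ∈ {b : Site d × Fin d | SideTouches (Ω j) b.1 b.2},
        U₁ b.1 b.2 = cfgExp η A b.1 b.2 ∧ IsSelfAdjoint (A b.1 b.2) ∧ ‖A b.1 b.2‖ ≤ cstar * ((L : ℝ) ^ j * η)⁻¹) →
      ∃ (v : Site d → 𝔸ˣ) (lam : Site d → 𝔸), (∀ x, v x ∈ unitaryUnits 𝔸) ∧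
        (∀ j, j ≤ m + 1 → ∀ b ∈ {b : Site d × Fin d | SideTouches (Ω j) b.1 b.2}, (v b.1 : 𝔸) = ((gaugeExp lam b.1 : 𝔸ˣ) : 𝔸) ∧
          (v (b.1 + e b.2) : 𝔸) = ((gaugeExp lam (b.1 + e b.2) : 𝔸ˣ) : 𝔸)) ∧
        (∀ j, j ≤ m + 1 → ∀ b ∈ {b : Site d × Fin d | SideTouches (Ω j) b.1 b.2},
          ‖lam b.1‖ ≤ α₄ ∧ ((L : ℝ) ^ j * η) * ‖covDerivFwd η U₀ b.2 lam b.1‖ ≤ α₄) ∧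
        Lan (m + 1) (mgauge U₀ v⁻¹ U₁) ∧ Restr129 L (m + 1) (Λs (m + 1)) U₀ (u₁ * v))
    (H42 : ∀ m, 1 ≤ m → m ≤ k → ∀ (u : Site d → 𝔸ˣ) (W : Site d → Fin d → 𝔸ˣ) (A' : Site d → Fin d → 𝔸),
      (∀ x, u x ∈ unitaryUnits 𝔸) → mgauge U₀ u W = U' → Restr129 L m (Λs m) U₀ u → Lan m W →
      (∀ y τ, IsSelfAdjoint (A' y τ)) →
      (∀ j, j ≤ m → ∀ y τ, SideTouches (Ω j) y τ →
        W y τ = cfgExp η A' y τ ∧ ‖A' y τ‖ ≤ (2 * (L * cstar) + 8 * α₄) * ((L : ℝ) ^ j * η)⁻¹) →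
      (∀ y τ, (∀ j, j ≤ m → ¬ SideTouches (Ω j) y τ) → A' y τ = 0) →
      ∀ j, j ≤ m → ∀ c ∈ Λb m j, ‖logCovIter L U₀ (iEta η A') j c.1 c.2‖ < 2 * d * L * α₁)
    (H59 : ∀ m, 1 ≤ m → m ≤ k → ∀ (u : Site d → 𝔸ˣ) (W : Site d → Fin d → 𝔸ˣ) (A' : Site d → Fin d → 𝔸),
      (∀ x, u x ∈ unitaryUnits 𝔸) → mgauge U₀ u W = U' → Restr129 L m (Λs m) U₀ u → Lan m W →
      (∀ y τ, IsSelfAdjoint (A' y τ)) →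
      (∀ j, j ≤ m → ∀ y τ, SideTouches (Ω j) y τ →
        W y τ = cfgExp η A' y τ ∧ ‖A' y τ‖ ≤ (2 * (L * cstar) + 8 * α₄) * ((L : ℝ) ^ j * η)⁻¹) →
      (∀ y τ, (∀ j, j ≤ m → ¬ SideTouches (Ω j) y τ) → A' y τ = 0) →
      msup L m η (-(1 : ℝ)) (fun j (b : Site d × Fin d) => SideTouches (Ω j) b.1 b.2) (fun b => A' b.1 b.2)
          ≤ B₀ * (bondNorm L m η (-(3 : ℝ)) Ω (fun x μ => Jcur η U₀ A' μ x)
            + wsup 1 (fun p : {p : ℕ × (Site d × Fin d) // p.1 ≤ m ∧ p.2 ∈ Λb m p.1} =>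
                linCovIter L U₀ (iEta η A') p.1.1 p.1.2.1 p.1.2.2)) ∧
        msup L m η (-(2 : ℝ)) (fun j (t : Fin d × Fin d × Site d) => SideTouches (Ω j) t.2.2 t.2.1)
            (fun t => covDerivFwd η U₀ t.1 (fun z => A' z t.2.1) t.2.2)
          ≤ B₀ * (bondNorm L m η (-(3 : ℝ)) Ω (fun x μ => Jcur η U₀ A' μ x)
            + wsup 1 (fun p : {p : ℕ × (Site d × Fin d) // p.1 ≤ m ∧ p.2 ∈ Λb m p.1} =>
                linCovIter L U₀ (iEta η A') p.1.1 p.1.2.1 p.1.2.2))) :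
    ∀ m, m ≤ k → ∃ u : Site d → 𝔸ˣ, (∀ x, u x ∈ unitaryUnits 𝔸) ∧ Restr129 L m (Λs m) U₀ u ∧
      ∃ W : Site d → Fin d → 𝔸ˣ, mgauge U₀ u W = U' ∧ (1 ≤ m → Lan m W) ∧
        ∃ A : Site d → Fin d → 𝔸, ∀ j, j ≤ m → ∀ b ∈ {b : Site d × Fin d | SideTouches (Ω j) b.1 b.2},
          W b.1 b.2 = cfgExp η A b.1 b.2 ∧ IsSelfAdjoint (A b.1 b.2) ∧ ‖A b.1 b.2‖ ≤ cstar * ((L : ℝ) ^ j * η)⁻¹ := by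
  have hL1 : 1 ≤ L := le_trans (by norm_num) hL
  have hcstar : 0 ≤ cstar := by rw [hc]; positivity
  have hE : ∀ j, {b : Site d × Fin d | SideTouches (Ω (j + 1)) b.1 b.2} ⊆ {b : Site d × Fin d | SideTouches (Ω j) b.1 b.2} :=
    fun j b hb => B8Eq140Level.sideTouches_mono (hΩ j) hb
  exact B8Thm4InductionLocal.thm4_exists_all_levels hL1 hη hU₀ hU' hcstar hα₄ hs₁ hs₂ ha ha2
    (fun j => {b : Site d × Fin d | SideTouches (Ω j) b.1 b.2}) hE h66 Λs Lan hP5base hP5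
    (hP3_gaugeFixed_of_b9 hd2 hη hL k hU₀ hU' hα₀ hα₁ hα₄ hB₀ hc hα3 hα4 h16 hd5 hsmall hc₃ hside h50 hC₂ h61 Ω Λs Λb hbox
      h33 h34 Lan H42 H59)

end Main

#print axioms hP3_gaugeFixed_of_b9
#print axioms thm4_exists_all_levels_of_b9

end Literature.MathematicalPhysics.QuantumFieldTheory.Balaban1983to89.B8Prop3GaugeFixedKLevel

end
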